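import Literature.AnabelianGeometry.EtaleTheta.FrobenioidThetaDivisors
import Literature.AnabelianGeometry.EtaleTheta.Discharge.Sec5Cor512UniversalClosureRefuted
import Literature.AlgebraicGeometry.Frobenioids.DirectSumPrimes
import HarnessLib

/-!
# [EtTh] §5, Prop. 5.3: a toy §5 datum with a CONTENTFUL divisor monoid `⊕_{ℤ ⊔ ℤ} ℚ_{≥0}` and toy
# cuspidal / non-cuspidal prime structures on it (kernel objects for the FACT-LIST rows F-0559/0561/0562/0563/0564/2497)

Mochizuki, *The étale theta function and its Frobenioid-theoretic manifestations*, Publ. RIMS **45**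
(2009), §5, Proposition 5.3 (Category-theoreticity of the Geometry of Divisors), pp. 325–326 (PDF pp.
99–100) [cite: MochizukiEtTh2009, Prop 5.3 p.325 (PDF p.99)]. Cell abc-iut, block F (fact-proving wave),
seat abc-iut-f-009 (unseated tranches 127–128 of `plan/F-TRANCHES.tsv`); companion of abc-iut-L2-t4's
statements file `FrobenioidThetaDivisors.lean`. No new `Prop` fact, no edit of the statement file; the
definitions are TOY DATA only (adapted from abc-iut-f-112's `ConstantMultiple.Cor512Toy.toyTheta`,
`Sec5Cor512UniversalClosureRefuted.lean`, whose category `TC`, base `TD`, Frobenius degree `degFrToy` and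
group-theoretic fields are reused verbatim). The refutations of the universal closures of Prop. 5.3 (i)–(vi)
as typed live in the proof-only sibling `Sec5Prop53UniversalClosureRefuted.lean`.

WHY A SECOND TOY. The typed Prop. 5.3 statements are predicates on `𝔉 : ThetaFrobenioid C D` (DATA ONLY)
and on the FREE stubs `T : DivisorTransportStub 𝔉`, `𝔓 : DivisorPrimeData 𝔉`; f-112's toy has `Φ(A_⊚) = 1`,
hence NO `𝔓` (`Prime^ncsp ≃ ℤ` fails) and every row is vacuous there. Here `toyThetaDiv` has
**`Φ(−) := ⊕_{ℤ ⊔ ℤ} ℚ_{≥0}`** (constant, identity pull-backs, divisors `0`), `Prime(Φ) ≃ ℤ ⊔ ℤ`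
(`DirectSum.primesEquiv`, abc-iut-L1-d2); `toyPrimeData`: `inl`-primes NON-CUSPIDAL, `inr`-primes CUSPIDAL,
`Prime^csp ↠ Prime^ncsp : inr n ↦ inl n`, labels `inl n ↦ n`, CANONICAL component isomorphisms,
`div(Θ̈) := [x_{inl 0}]`; `toyPrimeDataTwisted` twists the isomorphisms out of `P (inl 0)` / `P (inr 0)` by
DOUBLING in `ℚ_{≥0}`; `reindex σ` re-indexes along a permutation `σ` of `ℤ ⊔ ℤ` (the "`Ψ`-induced" `e`; with
`Ψ = 𝟭`, `ι = 𝟙`, `Ψ^Φ_{A_⊚} = e`: `psiPhi_toy`); `coord0 : Φ → ℚ` is the `inl 0`-coordinate.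

HONEST FRAMING: a toy datum says nothing about the tempered Frobenioid of [EtTh] §5, nothing about the truth
of Prop. 5.3 for it, and nothing about [IUTchIII] Cor. 3.12; no side is taken; typed ≠ proved.
-/

namespace Literature.AnabelianGeometry.EtaleTheta

namespace FrobenioidThetaDivisors

namespace Prop53Toy

open CategoryTheory
open Literature.AlgebraicGeometry.Frobenioids
open ConstantMultiple ConstantMultiple.Cor512Toy

/-! ### The divisor monoid `⊕_{ℤ ⊔ ℤ} ℚ_{≥0}` and its primes -/

/-- The index set of the primes of the toy divisor monoid: `inl n` = the `n`-th NON-cuspidal prime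
(irreducible component), `inr n` = the `n`-th CUSPIDAL prime (p.325 (PDF p.99): "the special fiber …
an infinite chain of copies of the projective line"). [cite: MochizukiEtTh2009, Prop 5.3 p.325 (PDF p.99)] -/
abbrev Idx : Type := ℤ ⊕ ℤ

/-- The factors of the toy divisor monoid: `ℚ_{≥0}` (written multiplicatively) at every index.
[cite: MochizukiEtTh2009, Prop 5.3 p.325 (PDF p.99)] -/
abbrev Fac : Idx → Type := fun _ => Multiplicative NNRat

/-- The toy divisor monoid `Φ := ⊕_{ℤ ⊔ ℤ} ℚ_{≥0}` (the tree's `directSum`).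
[cite: MochizukiEtTh2009, Prop 5.3 p.325 (PDF p.99)] -/
abbrev Φt : Type := ↥(directSum Fac)

/-- Every factor `ℚ_{≥0}` is monoprime ([FrdI] §0). [cite: MochizukiFrdI2008, §0 p.10] -/
theorem fac_monoprime : ∀ i : Idx, IsMonoprime (Fac i) := fun _ => IsMonoprime.ofQ ⟨⟨MulEquiv.refl _⟩⟩

/-- `idx 𝔭 ∈ ℤ ⊔ ℤ`, the index of a prime of `Φ` (`DirectSum.idx`). [cite: MochizukiFrdI2008, §0 p.12] -/
noncomputable abbrev idx : Primes Φt → Idx := DirectSum.idx fac_monoprime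

/-- `P_i`, the prime of `Φ` at the index `i` (`DirectSum.primeOf`). [cite: MochizukiFrdI2008, §0 p.12] -/
noncomputable abbrev P (i : Idx) : Primes Φt := DirectSum.primeOf fac_monoprime i

/-- `idx (P i) = i`. [cite: MochizukiFrdI2008, §0 p.12] -/
theorem idx_P (i : Idx) : idx (P i) = i := DirectSum.idx_primeOf fac_monoprime i

/-- `P (idx 𝔭) = 𝔭`. [cite: MochizukiFrdI2008, §0 p.12] -/
theorem P_idx (𝔭 : Primes Φt) : P (idx 𝔭) = 𝔭 := DirectSum.primeOf_idx fac_monoprime 𝔭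

/-- Two primes sharing an element of their subsets are equal. [cite: MochizukiFrdI2008, §0 p.12] -/
theorem primes_eq_of_mem_carrier {M : Type*} [CommMonoid M] {𝔭 𝔮 : Primes M} {a : M}
    (hp : a ∈ 𝔭.carrier) (hq : a ∈ 𝔮.carrier) : 𝔭 = 𝔮 := by
  obtain ⟨h₁, rfl⟩ := hp
  obtain ⟨h₂, rfl⟩ := hq
  rfl

/-- Every prime has an element in its subset. [cite: MochizukiFrdI2008, §0 p.12] -/
theorem exists_mem_carrier {M : Type*} [CommMonoid M] (𝔭 : Primes M) : ∃ a, a ∈ 𝔭.carrier := by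
  induction 𝔭 using Quotient.inductionOn with
  | h a => exact ⟨a.1, a.2, rfl⟩

/-- `ofAdd 1 ≠ 1` in multiplicative `ℚ_{≥0}`. [folklore] -/
private theorem q1_ne_one : (Multiplicative.ofAdd (1 : NNRat)) ≠ 1 := by
  rw [Ne, ← ofAdd_zero, Multiplicative.ofAdd.injective.eq_iff]; exact one_ne_zero

/-- The generator `x_i := single i 1` (additively `1 ∈ ℚ_{≥0}` at `i`) lies in the subset of `P i`.
[cite: MochizukiFrdI2008, §0 p.12] -/
theorem single_mem_carrier (i : Idx) :
    DirectSum.single (M := Fac) i (Multiplicative.ofAdd 1) ∈ (P i).carrier :=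
  (DirectSum.mem_carrier_primeOf_iff fac_monoprime i _).mpr (DirectSum.dsupp_single q1_ne_one)

/-! ### Re-indexing automorphisms of `⊕_{ℤ ⊔ ℤ} ℚ_{≥0}` -/

/-- Re-indexing along `σ`: `(e f)_j := f_{σ⁻¹ j}` (finite support is preserved).
[cite: MochizukiEtTh2009, Prop 5.3 p.325 (PDF p.99)] -/
def reindexFun (σ : Idx ≃ Idx) (f : Φt) : Φt :=
  ⟨fun j => (f : ∀ j, Fac j) (σ.symm j), by
    refine ((DirectSum.finite_dsupp f).image σ).subset fun j hj => ?_
    exact ⟨σ.symm j, hj, σ.apply_symm_apply j⟩⟩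

/-- Components of `reindexFun`. [cite: MochizukiEtTh2009, Prop 5.3 p.325 (PDF p.99)] -/
@[simp] theorem reindexFun_apply (σ : Idx ≃ Idx) (f : Φt) (j : Idx) :
    (reindexFun σ f : ∀ j, Fac j) j = (f : ∀ j, Fac j) (σ.symm j) := rfl

/-- **`reindex σ`**, the automorphism of the monoid `⊕_{ℤ ⊔ ℤ} ℚ_{≥0}` re-indexing the components along
the permutation `σ` (it plays the "`Ψ`-induced isomorphism of divisor monoids" `e`).
[cite: MochizukiEtTh2009, Prop 5.3 p.325 (PDF p.99)] -/
def reindex (σ : Idx ≃ Idx) : Φt ≃* Φt where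
  toFun := reindexFun σ
  invFun := reindexFun σ.symm
  left_inv f := Subtype.ext (funext fun j => by
    change (f : ∀ j, Fac j) (σ.symm (σ.symm.symm j)) = _
    rw [Equiv.symm_symm, Equiv.symm_apply_apply])
  right_inv f := Subtype.ext (funext fun j => by
    change (f : ∀ j, Fac j) (σ.symm.symm (σ.symm j)) = _
    rw [Equiv.symm_symm, Equiv.apply_symm_apply])
  map_mul' f g := Subtype.ext (funext fun j => rfl)

/-- `reindex σ (single i a) = single (σ i) a`. [cite: MochizukiEtTh2009, Prop 5.3 p.325 (PDF p.99)] -/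
theorem reindex_single (σ : Idx ≃ Idx) (i : Idx) (a : Multiplicative NNRat) :
    reindex σ (DirectSum.single (M := Fac) i a) = DirectSum.single (M := Fac) (σ i) a := by
  refine Subtype.ext (funext fun j => ?_)
  change (DirectSum.single (M := Fac) i a : ∀ j, Fac j) (σ.symm j) = (DirectSum.single (M := Fac) (σ i) a : ∀ j, Fac j) j
  by_cases h : j = σ i
  · subst h
    rw [Equiv.symm_apply_apply, DirectSum.single_apply_same, DirectSum.single_apply_same]
  · rw [DirectSum.single_apply_of_ne h, DirectSum.single_apply_of_ne]
    intro h'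
    exact h ((Equiv.symm_apply_eq σ).mp h')

/-- `reindex σ` carries the prime `P i` to the prime `P (σ i)`. [cite: MochizukiFrdI2008, §0 p.12] -/
theorem congr_reindex_P (σ : Idx ≃ Idx) (i : Idx) : Primes.congr (reindex σ) (P i) = P (σ i) := by
  have h₁ : reindex σ (DirectSum.single (M := Fac) i (Multiplicative.ofAdd 1)) ∈
      (Primes.congr (reindex σ) (P i)).carrier := by
    rw [Primes.carrier_congr]
    exact ⟨_, single_mem_carrier i, rfl⟩
  rw [reindex_single] at h₁
  exact primes_eq_of_mem_carrier h₁ (single_mem_carrier (σ i))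

/-- Hence `idx (Ψ^Φ 𝔭) = σ (idx 𝔭)` for `Ψ^Φ = reindex σ`. [cite: MochizukiFrdI2008, §0 p.12] -/
theorem idx_congr_reindex (σ : Idx ≃ Idx) (𝔭 : Primes Φt) :
    idx (Primes.congr (reindex σ) 𝔭) = σ (idx 𝔭) := by
  conv_lhs => rw [← P_idx 𝔭]
  rw [congr_reindex_P, idx_P]

/-! ### The toy §5 datum with divisor monoid `⊕_{ℤ ⊔ ℤ} ℚ_{≥0}` -/

/-- The toy pre-Frobenioid data: constant base, divisor monoid `⊕_{ℤ ⊔ ℤ} ℚ_{≥0}` at every object with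
IDENTITY pull-backs, all divisors `0`, f-112's toy Frobenius degree. [cite: MochizukiEtTh2009, Prop 5.3 p.325 (PDF p.99)] -/
def toyPreDiv : PreFrobenioidData.{0} TC TD where
  base := (Functor.const TC).obj ⟨PUnit.unit⟩
  Mon := fun _ => Φt
  pull := fun _ => MonoidHom.id Φt
  pull_id := fun _ _ => rfl
  pull_comp := fun _ _ _ => rfl
  div := fun _ => 1
  degFr := fun φ => degFrToy φ
  div_id := fun _ => rfl
  div_comp := fun _ _ => by simp
  degFr_id := fun A => by simp [degFrToy]
  degFr_comp := fun ψ φ => degFrToy_comp ψ φ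

/-- The toy `TemperedFrobenioidStub` (as f-112's, over `toyPreDiv`). [cite: MochizukiEtTh2009, §5 p.331 (PDF p.105)] -/
def toyStubDiv : FrobenioidTheta.TemperedFrobenioidStub.{0} TC TD where
  pre := toyPreDiv
  units_comm S := ⟨⟨fun a b => Subtype.ext (aut_mul_comm S a.1 b.1)⟩⟩
  biratUnits := fun _ => Mm
  unitsToBirat S := (autToM S).comp (toyPreDiv.unitsSubgroup S).subtype
  unitsToBirat_injective S := by
    intro a b h
    apply Subtype.ext
    apply Aut.ext
    exact Prod.ext (Subsingleton.elim _ _) h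
  unitsPull := fun _ => 1
  IsBaseFrobeniusType := ⊤

/-- **The toy §5 datum with a contentful divisor monoid** `𝔉_div : ThetaFrobenioid C D`: f-112's `toyTheta`
with `Φ(−) := ⊕_{ℤ ⊔ ℤ} ℚ_{≥0}` (`A_⊚ = A_N = B_N = Q`, `s^⊓_N = s^⊔_N = 𝟙`, `N = 2`, `l = 1`,
`Π^tp_X = ℤ × ℤ/2` discrete, `Π^tp_Ÿ = 1`, `K = 𝔽₂`, all sections trivial).
[cite: MochizukiEtTh2009, Prop 5.3 p.325 (PDF p.99)] -/
def toyThetaDiv : ThetaFrobenioid.{0} TC TD where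
  toTemperedFrobenioidStub := toyStubDiv
  lDelta := fun _ => Unit
  lDeltaMap := fun _ => MonoidHom.id Unit
  l := 1
  odd_l := odd_one
  N := 2
  Acirc := Q
  AN := Q
  BN := Q
  sCap := 𝟙 Q
  sCup := 𝟙 Q
  base_map_sCap := rfl
  isPreStep_sCap := ⟨toyPreDiv.degFr_id Q, by change IsIso (𝟙 _); infer_instance⟩
  isPreStep_sCup := ⟨toyPreDiv.degFr_id Q, by change IsIso (𝟙 _); infer_instance⟩
  PiX := Multiplicative ℤ × Mm
  zquot := MonoidHom.fst _ _
  zquot_surjective := fun z => ⟨(z, 1), rfl⟩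
  PiYdd := ⊥
  PiYdd_le := bot_le
  relindex_PiYdd := by
    rw [Subgroup.relIndex_bot_left, Nat.card_congr kerFstEquiv, Nat.card_zmod]
  PiYdd_normal := inferInstance
  isOpen_PiYdd := isOpen_discrete _
  ρ := 1
  ρ_surjective := fun g => ⟨1, Aut.ext (Subsingleton.elim _ _)⟩
  isOpen_ker_ρ := isOpen_discrete _
  strv := 1
  sgpCap := 1
  sgpCup := 1
  K := ZMod 2
  constEmb := 1
  constEmb_injective := by
    intro a b _
    have h : ∀ u : (ZMod 2)ˣ, u = 1 := by decide
    rw [h a, h b]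
  thetaFn := (1 : Mm)

/-- `Φ(A_⊚) = ⊕_{ℤ ⊔ ℤ} ℚ_{≥0}` in the toy datum. [cite: MochizukiEtTh2009, Prop 5.3 p.325 (PDF p.99)] -/
theorem phiAcirc_eq : toyThetaDiv.PhiAcirc = Φt := rfl

/-- In the toy datum `Ψ^Φ_{A_⊚} = e` for `Ψ = 𝟭`, `ι = 𝟙`. [cite: MochizukiEtTh2009, Prop 5.3 p.325 (PDF p.99)] -/
theorem psiPhi_toy (e : Φt ≃* Φt) (a : Φt) :
    psiPhi toyThetaDiv ((CategoryTheory.Equivalence.refl : TC ≌ TC)) (Iso.refl Q) e a = e a := rfl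

/-- In the toy datum `Aut_C(A_⊚)` acts trivially on `Φ(A_⊚)`. [cite: MochizukiEtTh2009, Prop 5.3 (vi) p.326 (PDF p.100)] -/
theorem pullAut_toy (g : Aut (toyThetaDiv.Acirc)) (a : Φt) : toyThetaDiv.pullAut g a = a := rfl

/-- The all-true transport stub: every `e` "is induced by `Ψ`". [cite: MochizukiEtTh2009, Prop 5.3 p.325 (PDF p.99)] -/
def trueTransport : DivisorTransportStub toyThetaDiv where
  IsInducedBy := fun _ _ _ => True

/-! ### The toy cuspidal / non-cuspidal structure on `Prime(Φ(A_⊚)) ≃ ℤ ⊔ ℤ` -/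

/-- A prime of the toy `Φ(A_⊚)` is CUSPIDAL iff its index is `inr n`. [cite: MochizukiEtTh2009, Prop 5.3 p.325 (PDF p.99)] -/
def IsCusp (𝔭 : Primes Φt) : Prop := ∃ n : ℤ, idx 𝔭 = Sum.inr n

/-- `P (inr n)` is cuspidal. [cite: MochizukiEtTh2009, Prop 5.3 p.325 (PDF p.99)] -/
theorem isCusp_P_inr (n : ℤ) : IsCusp (P (Sum.inr n)) := ⟨n, idx_P _⟩

/-- `P (inl n)` is not cuspidal. [cite: MochizukiEtTh2009, Prop 5.3 p.325 (PDF p.99)] -/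
theorem not_isCusp_P_inl (n : ℤ) : ¬ IsCusp (P (Sum.inl n)) := by
  rintro ⟨m, hm⟩
  rw [idx_P] at hm
  exact Sum.inl_ne_inr hm

/-- A non-cuspidal prime has index `inl n`. [cite: MochizukiEtTh2009, Prop 5.3 p.325 (PDF p.99)] -/
theorem idx_eq_inl_of_not_isCusp {𝔭 : Primes Φt} (h : ¬ IsCusp 𝔭) : ∃ n, idx 𝔭 = Sum.inl n := by
  rcases hi : idx 𝔭 with n | n
  · exact ⟨n, rfl⟩
  · exact (h ⟨n, hi⟩).elim

/-- The label of a prime: `inl n ↦ n`, `inr n ↦ n`. [cite: MochizukiEtTh2009, Prop 5.3 (v) p.325 (PDF p.99)] -/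
noncomputable def label (𝔭 : Primes Φt) : ℤ := Sum.elim id id (idx 𝔭)

/-- `label (P (inl n)) = n`. [cite: MochizukiEtTh2009, Prop 5.3 (v) p.325 (PDF p.99)] -/
theorem label_P_inl (n : ℤ) : label (P (Sum.inl n)) = n := by
  simp [label, idx_P]

/-- The canonical isomorphism between two primary components of `⊕ ℚ_{≥0}` (both `≅ ℚ_{≥0}` by evaluation
at their index). [cite: MochizukiEtTh2009, Prop 5.3 (ii) p.325 (PDF p.99)] -/
noncomputable def canonIso (𝔭 𝔮 : Primes Φt) : ↥𝔭.submonoid ≃* ↥𝔮.submonoid :=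
  (DirectSum.submonoidEquiv fac_monoprime 𝔭 (idx 𝔭) (P_idx 𝔭)).trans
    (DirectSum.submonoidEquiv fac_monoprime 𝔮 (idx 𝔮) (P_idx 𝔮)).symm

/-- **The toy `DivisorPrimeData`**: cuspidal primes = `inr`-indexed, cuspidal (resp. non-cuspidal)
ELEMENTS = those lying in the subset of a cuspidal (resp. non-cuspidal) prime, canonical component
isomorphisms, `Prime^csp ↠ Prime^ncsp : P (inr n) ↦ P (inl n)`, labels `P (inl n) ↦ n`,
`div(Θ̈) := [x_{inl 0}]`. [cite: MochizukiEtTh2009, Prop 5.3 p.325 (PDF p.99)] -/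
noncomputable def toyPrimeData : DivisorPrimeData toyThetaDiv where
  IsCuspidalElt a := ∀ 𝔭 : Primes Φt, a ∈ 𝔭.carrier → IsCusp 𝔭
  IsNonCuspidalElt a := ∀ 𝔭 : Primes Φt, a ∈ 𝔭.carrier → ¬ IsCusp 𝔭
  IsCuspidal := IsCusp
  isCuspidal_iff 𝔭 := by
    constructor
    · intro h a ha 𝔮 hq
      rwa [← primes_eq_of_mem_carrier ha hq]
    · intro h
      obtain ⟨a, ha⟩ := exists_mem_carrier 𝔭
      exact h a ha 𝔭 ha
  ncspIso 𝔭 𝔮 _ _ := canonIso 𝔭 𝔮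
  cspIso 𝔭 𝔮 _ _ := canonIso 𝔭 𝔮
  cspToNcsp 𝔭 := ⟨P (Sum.inl (label 𝔭.1)), not_isCusp_P_inl _⟩
  cspToNcsp_surjective := by
    rintro ⟨𝔮, hq⟩
    obtain ⟨n, hn⟩ := idx_eq_inl_of_not_isCusp hq
    refine ⟨⟨P (Sum.inr n), isCusp_P_inr n⟩, Subtype.ext ?_⟩
    change P (Sum.inl (label (P (Sum.inr n)))) = 𝔮
    have : label (P (Sum.inr n)) = n := by simp [label, idx_P]
    rw [this, ← hn, P_idx]
  ncspEquivZ :=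
    { toFun := fun 𝔭 => label 𝔭.1
      invFun := fun n => ⟨P (Sum.inl n), not_isCusp_P_inl n⟩
      left_inv := by
        rintro ⟨𝔭, hp⟩
        obtain ⟨n, hn⟩ := idx_eq_inl_of_not_isCusp hp
        apply Subtype.ext
        change P (Sum.inl (label 𝔭)) = 𝔭
        have : label 𝔭 = n := by simp [label, hn]
        rw [this, ← hn, P_idx]
      right_inv := fun n => label_P_inl n }
  divTheta := Algebra.GrothendieckGroup.of (DirectSum.single (M := Fac) (Sum.inl 0) (Multiplicative.ofAdd 1))

/-! ### The permutations `σ` of `ℤ ⊔ ℤ`, the coordinate `coord0`, and the twisted prime structure -/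

/-- The transposition `inl 0 ↔ inr 0` of `ℤ ⊔ ℤ` (exchanges a non-cuspidal and a cuspidal index).
[cite: MochizukiEtTh2009, Prop 5.3 (i) p.325 (PDF p.99)] -/
def swapCusp : Idx ≃ Idx := Equiv.swap (Sum.inl 0) (Sum.inr 0)

/-- The transposition `inl 0 ↔ inl 1` of `ℤ ⊔ ℤ` (exchanges two NON-cuspidal indices, fixes the rest).
[cite: MochizukiEtTh2009, Prop 5.3 (v) p.325 (PDF p.99)] -/
def swapNcsp : Idx ≃ Idx := Equiv.swap (Sum.inl 0) (Sum.inl 1)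

/-- `Ψ^Φ_{A_⊚} = reindex σ` as an isomorphism of monoids (toy datum, `Ψ = 𝟭`, `ι = 𝟙`).
[cite: MochizukiEtTh2009, Prop 5.3 p.325 (PDF p.99)] -/
theorem psiPhi_toy_eq (e : Φt ≃* Φt) :
    psiPhi toyThetaDiv (CategoryTheory.Equivalence.refl : TC ≌ TC) (Iso.refl Q) e = e :=
  MulEquiv.ext (psiPhi_toy e)

/-- The `inl 0`-coordinate `⊕_{ℤ ⊔ ℤ} ℚ_{≥0} → ℚ` (into the multiplicatively written additive GROUP `ℚ`), a
homomorphism separating `x_{inl 0}` from `x_{inl 1}` in `Φ^gp`. [cite: MochizukiEtTh2009, Prop 5.3 (vi) p.326 (PDF p.100)] -/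
noncomputable def coord0 : Φt →* Multiplicative ℚ :=
  (AddMonoidHom.toMultiplicative (NNRat.coeHom : ℚ≥0 →+* ℚ).toAddMonoidHom).comp
    ((Pi.evalMonoidHom Fac (Sum.inl 0)).comp (directSum Fac).subtype)

/-- Doubling `q ↦ 2q` as an automorphism of the additive monoid `ℚ_{≥0}` (plumbing for the twisted component isomorphisms). [cite: MochizukiEtTh2009, Prop 5.3 (ii) p.325 (PDF p.99)] -/
def twoMul : NNRat ≃+ NNRat where
  toFun x := 2 * x
  invFun x := 2⁻¹ * x
  left_inv x := inv_mul_cancel_left₀ two_ne_zero x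
  right_inv x := mul_inv_cancel_left₀ two_ne_zero x
  map_add' x y := mul_add 2 x y

/-- Doubling as an automorphism of multiplicatively written `ℚ_{≥0}` (a NON-TRIVIAL automorphism of a
primary component `Φ(A_⊚)_𝔭 ≅ ℚ_{≥0}`). [cite: MochizukiEtTh2009, Prop 5.3 (ii) p.325 (PDF p.99)] -/
def doubling : Multiplicative NNRat ≃* Multiplicative NNRat := AddEquiv.toMultiplicative twoMul

/-- `doubling (ofAdd 1) = ofAdd 2` (the twist is non-trivial on the generator `x_𝔭`). [cite: MochizukiEtTh2009, Prop 5.3 (ii) p.325 (PDF p.99)] -/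
theorem doubling_one : doubling (Multiplicative.ofAdd (1 : NNRat)) = Multiplicative.ofAdd 2 := by
  change Multiplicative.ofAdd (2 * (1 : NNRat)) = _
  rw [mul_one]

/-- The TWISTED component isomorphisms: out of the prime of index `i₀` the canonical isomorphism followed by
doubling, out of every other prime the canonical one (every `Φ(A_⊚)_𝔭 ≃* Φ(A_⊚)_𝔮` is allowed by the typed
interface). [cite: MochizukiEtTh2009, Prop 5.3 (ii) p.325 (PDF p.99)] -/
noncomputable def twistIso (i₀ : Idx) (𝔭 𝔮 : Primes Φt) : ↥𝔭.submonoid ≃* ↥𝔮.submonoid :=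
  if idx 𝔭 = i₀ then
    (DirectSum.submonoidEquiv fac_monoprime 𝔭 (idx 𝔭) (P_idx 𝔭)).trans
      (doubling.trans (DirectSum.submonoidEquiv fac_monoprime 𝔮 (idx 𝔮) (P_idx 𝔮)).symm)
  else canonIso 𝔭 𝔮

/-- Value of the twisted isomorphism out of the twisted prime. [cite: MochizukiEtTh2009, Prop 5.3 (ii) p.325 (PDF p.99)] -/
theorem twistIso_val_eq {i₀ j : Idx} {𝔭 𝔮 : Primes Φt} (hi : idx 𝔭 = i₀) (hj : idx 𝔮 = j)
    (x : ↥𝔭.submonoid) :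
    ((twistIso i₀ 𝔭 𝔮 x : ↥𝔮.submonoid) : Φt) = DirectSum.single (M := Fac) j (doubling (((x : Φt) : ∀ j, Fac j) i₀)) := by
  subst hi hj
  unfold twistIso
  rw [if_pos rfl]
  rfl

/-- Value of the twisted isomorphism out of any other prime (the canonical one).
[cite: MochizukiEtTh2009, Prop 5.3 (ii) p.325 (PDF p.99)] -/
theorem twistIso_val_ne {i₀ i j : Idx} {𝔭 𝔮 : Primes Φt} (hi : idx 𝔭 = i) (hne : i ≠ i₀) (hj : idx 𝔮 = j)
    (x : ↥𝔭.submonoid) :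
    ((twistIso i₀ 𝔭 𝔮 x : ↥𝔮.submonoid) : Φt) = DirectSum.single (M := Fac) j (((x : Φt) : ∀ j, Fac j) i) := by
  subst hi hj
  unfold twistIso
  rw [if_neg hne]
  rfl

/-- **The twisted toy `DivisorPrimeData`**: as `toyPrimeData`, except that the isomorphisms between NON-cuspidal
components out of `P (inl 0)`, and between CUSPIDAL components out of `P (inr 0)`, are twisted by doubling.
[cite: MochizukiEtTh2009, Prop 5.3 p.325 (PDF p.99)] -/
noncomputable def toyPrimeDataTwisted : DivisorPrimeData toyThetaDiv where
  IsCuspidalElt a := ∀ 𝔭 : Primes Φt, a ∈ 𝔭.carrier → IsCusp 𝔭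
  IsNonCuspidalElt a := ∀ 𝔭 : Primes Φt, a ∈ 𝔭.carrier → ¬ IsCusp 𝔭
  IsCuspidal := IsCusp
  isCuspidal_iff := toyPrimeData.isCuspidal_iff
  ncspIso 𝔭 𝔮 _ _ := twistIso (Sum.inl 0) 𝔭 𝔮
  cspIso 𝔭 𝔮 _ _ := twistIso (Sum.inr 0) 𝔭 𝔮
  cspToNcsp := toyPrimeData.cspToNcsp
  cspToNcsp_surjective := toyPrimeData.cspToNcsp_surjective
  ncspEquivZ := toyPrimeData.ncspEquivZ
  divTheta := toyPrimeData.divTheta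

/-- The transposition `inr 0 ↔ inr 1` of `ℤ ⊔ ℤ` (exchanges two CUSPIDAL indices, fixes the rest).
[cite: MochizukiEtTh2009, Prop 5.3 (iii) p.325 (PDF p.99)] -/
def swapCsp : Idx ≃ Idx := Equiv.swap (Sum.inr 0) (Sum.inr 1)

end Prop53Toy

end FrobenioidThetaDivisors

end Literature.AnabelianGeometry.EtaleTheta

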